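/-
Width seat `ym-line-sgb-p1-w3` (gen 2, seat prover-ym-line-sgb-p1-w3-g2-0), route `SteinGapBootstrap`, crux U `FreeProbeLawG`
(stmt-QuantumFields-23756), line `birth` (lead ym-line-sgb-k1-g1, RESHAPE 2), registered stub `stub_fieldBounds`.
-/
import Summits.QuantumFields.YangMills.Theorems.SteinGapBootstrapProbeCovFromPairLawGAxis
import Summits.QuantumFields.YangMills.Theorems.EquipartitionCriticalityEquipartitionPinsProbeTangentSecondMoments
import HarnessLib

/-!
# Line `birth` of crux U `FreeProbeLawG`: stub `stub_fieldBounds` — PROVED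

NOT THE CLAY GAP: route `SteinGapBootstrap` bears on the RECORD-label rung leaf R2ξ′ `WeakCouplingRates.XiPow` (an UPPER bound on the
lattice mass gap of torus-limit states); U itself stays open (child C1ᶠ `PairSteinDiscrepancyFreeG`, stmt-QuantumFields-23798).

(a) **Axis plaquettes**: for `x` on the time axis and `β > 0`, `Σ_a (Y^a_{(x;1,2)})² ≤ 2β (N − Re tr ρ(U_{(x;1,2)}))` — in the comb gauge
the `(1,2)`-plaquette at an axis site has exactly one live link `e = (x+e₂,1)`, `Y^a = -√β⟨ρ(Ũ_e) − 1, e_a⟩`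
(`ProbeCovFromPairLaw.axis_plaqField`), Bessel for the orthonormal Lie frame (`TangentSecondMoments.sum_lieCoord_sq_le`) and
`Re tr ρ(Ũ_e) = Re tr ρ(U_{(x;1,2)})` (`ProbeCovFromPairLaw.axis_energy`).  No chart constant enters.

(b) **Polynomial second moments**: under a state with `β·E_μ[N − Re tr ρ(U_q)] ≤ E₀` at every plaquette and `β ≥ 1`,
`E_μ (Y_p^a)² ≤ 32·max(E₀,0)·(1 + Σ_k |p_k|)²`.  This is the comb-gauge Poincaré inequality WITH LINEAR CONSTANTS: in the Frobenius
distance `δ(g) = ‖ρ(g) − 1‖_F` (subadditive, invariant under inversion and conjugation) the one-plaquette transport of the tree's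
`TangentCombPoincare.holonomy_axialFix_of_top` gives `δ(Ũ_e) ≤ Σ_{l<depth(e)} δ(U_{q_l})`, `depth(x,j) = Σ_{k>j}|x_k|`
(`comb_dist_bound`), whence by Cauchy–Schwarz `N − Re tr ρ(Ũ_e) ≤ depth(e)·Σ_l (N − Re tr ρ(U_{q_l}))` (`comb_energy_le`; the squared
recursion of `TangentCombPoincare.comb_bound` would give `2^depth`), and `(Y_p^a)² ≤ 8β Σ_{i<4} (N − Re tr ρ(Ũ_{∂_i p}))`
(`TangentFieldMoments.plaqField_sq_le`) integrates to the claim since `depth(∂_i p) ≤ 1 + Σ_k|p_k|`.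

References: S. Chatterjee, arXiv:1602.01222, §9 (axial gauge), Lemma 10.2 (comb Poincaré) [arXiv160201222]; R. A. Horn, C. R. Johnson,
Matrix Analysis (2013), Thm 2.2.2 (unitary invariance of the Frobenius norm) [HornJohnson2013].
-/

set_option autoImplicit false

noncomputable section

open scoped Matrix Matrix.Norms.Frobenius
open MeasureTheory
open Literature.Probability.LatticeModels Literature.MathematicalPhysics.QuantumLattice
  Literature.MathematicalPhysics.QuantumFieldTheory
open Summit.QuantumFields.YangMills.Theorems.EquipartitionPinsProbe
open Summit.QuantumFields.YangMills.Theorems.SteinGapBootstrap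

namespace Summit.QuantumFields.YangMills.Cruxes.FreeProbeLawG.SteinFree

namespace FieldBounds

/-! ### The Frobenius distance to `1` along the comb transport -/

section Dist

variable {G : Type} [Group G] {N : ℕ} (ρ : G →* Matrix (Fin N) (Fin N) ℂ)
  (hρ : ∀ g, ρ g ∈ Matrix.unitaryGroup (Fin N) ℂ)
include hρ

/-- **One transport step in the Frobenius distance**: if the coordinates of `z` above `k` vanish and `j < k`, then with
`q = (z; j, k)`: `δ(Ũ(z,j)) ≤ δ(U_q) + δ(Ũ(z+e_k,j))` and `δ(Ũ(z+e_k,j)) ≤ δ(U_q) + δ(Ũ(z,j))` (`Ũ_q = Ũ(z,j)Ũ(z+e_k,j)⁻¹`,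
`δ(Ũ_q) = δ(U_q)` by conjugation invariance). [cite: arXiv160201222, Lemma 10.2] -/
theorem dist_transport (U : LGConfig 4 G) {z : Site 4} {j k : Fin 4} (hjk : j < k)
    (hz : ∀ k' : Fin 4, k < k' → z k' = 0) :
    ‖ρ (axialFix U (z, j)) - 1‖ ≤ ‖ρ (plaquetteHolonomyZd U z j k) - 1‖ + ‖ρ (axialFix U (z + Pi.single k 1, j)) - 1‖ ∧
      ‖ρ (axialFix U (z + Pi.single k 1, j)) - 1‖ ≤
        ‖ρ (plaquetteHolonomyZd U z j k) - 1‖ + ‖ρ (axialFix U (z, j)) - 1‖ := by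
  -- Frobenius distance: invariance under inversion and conjugation (tree: `ColdBoxAllGroups.frobDist_inv/_conj`, restated
  -- locally to keep this file's import cone inside the `EquipartitionPinsProbe` tangent files)
  have hinv : ∀ g : G, ‖ρ g⁻¹ - 1‖ = ‖ρ g - 1‖ := fun g => by
    have h : (ρ g)ᴴ - 1 = (ρ g - 1)ᴴ := by rw [Matrix.conjTranspose_sub, Matrix.conjTranspose_one]
    rw [TangentCombPoincare.map_inv_eq_conjTranspose ρ hρ, h, Matrix.frobenius_norm_conjTranspose]
  have hconj : ∀ h g : G, ‖ρ (h * g * h⁻¹) - 1‖ = ‖ρ g - 1‖ := fun h g => by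
    have hi : ρ h * ρ h⁻¹ = 1 := by rw [← map_mul, mul_inv_cancel, map_one]
    have e : ρ (h * g * h⁻¹) - 1 = ρ h * (ρ g - 1) * ρ h⁻¹ := by
      rw [map_mul, map_mul, mul_sub, sub_mul, mul_one, hi]
    rw [e, Matrix.frobenius_norm_mul_unitaryGroup _ ⟨ρ h⁻¹, hρ h⁻¹⟩,
      Matrix.frobenius_norm_unitaryGroup_mul ⟨ρ h, hρ h⟩]
  have hq := TangentCombPoincare.holonomy_axialFix_of_top U hjk hz
  have hE : ‖ρ (plaquetteHolonomyZd (axialFix U) z j k) - 1‖ = ‖ρ (plaquetteHolonomyZd U z j k) - 1‖ := by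
    rw [CombBasics.plaquetteHolonomyZd_axialFix, hconj]
  constructor
  · have h : axialFix U (z, j) = plaquetteHolonomyZd (axialFix U) z j k * axialFix U (z + Pi.single k 1, j) := by
      rw [hq, inv_mul_cancel_right]
    rw [h, map_mul, ← hE]
    exact TangentCombPoincare.norm_mul_sub_one_le (hρ _) _
  · have h : axialFix U (z + Pi.single k 1, j) = (plaquetteHolonomyZd (axialFix U) z j k)⁻¹ * axialFix U (z, j) := by
      rw [hq, mul_inv_rev, inv_inv, inv_mul_cancel_right]
    rw [h, map_mul, ← hE, ← hinv (plaquetteHolonomyZd (axialFix U) z j k)]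
    exact TangentCombPoincare.norm_mul_sub_one_le (hρ _) _

omit hρ in
/-- Assembly of one transport step with the inductive bound (lists of plaquettes indexed by `Fin n`). [folklore] -/
theorem assemble_dist {x y : Site 4} {j : Fin 4} (q : ZdPlaquette 4) {n : ℕ}
    (hkey : ∀ U : LGConfig 4 G, ‖ρ (axialFix U (x, j)) - 1‖ ≤
      ‖ρ (plaquetteHolonomyZd U q.1 q.2.1.1 q.2.1.2) - 1‖ + ‖ρ (axialFix U (y, j)) - 1‖)
    (ih : ∃ f : Fin n → ZdPlaquette 4, ∀ U : LGConfig 4 G,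
      ‖ρ (axialFix U (y, j)) - 1‖ ≤ ∑ l, ‖ρ (plaquetteHolonomyZd U (f l).1 (f l).2.1.1 (f l).2.1.2) - 1‖) :
    ∃ f : Fin (n + 1) → ZdPlaquette 4, ∀ U : LGConfig 4 G,
      ‖ρ (axialFix U (x, j)) - 1‖ ≤ ∑ l, ‖ρ (plaquetteHolonomyZd U (f l).1 (f l).2.1.1 (f l).2.1.2) - 1‖ := by
  obtain ⟨f, hf⟩ := ih
  refine ⟨Matrix.vecCons q f, fun U => ?_⟩
  rw [Fin.sum_univ_succ]
  simp only [Matrix.cons_val_zero, Matrix.cons_val_succ]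
  linarith [hkey U, hf U]

/-- **The comb-gauge Poincaré inequality in the Frobenius distance**, by induction on the comb depth `n = Σ_{k>j}|x_k|` of the edge
`(x, j)`: `δ(Ũ(x,j)) ≤ Σ_{l<n} δ(U_{q_l})` for `n` plaquettes `q_l` (each transport step contributes one plaquette).
[cite: arXiv160201222, Lemma 10.2] -/
theorem comb_dist_bound : ∀ (n : ℕ) (x : Site 4) (j : Fin 4), ∑ k ∈ Finset.Ioi j, (x k).natAbs = n →
    ∃ f : Fin n → ZdPlaquette 4, ∀ U : LGConfig 4 G,
      ‖ρ (axialFix U (x, j)) - 1‖ ≤ ∑ l, ‖ρ (plaquetteHolonomyZd U (f l).1 (f l).2.1.1 (f l).2.1.2) - 1‖ := by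
  intro n
  induction n with
  | zero =>
    intro x j h0
    refine ⟨fun l => l.elim0, fun U => ?_⟩
    rw [CombBasics.axialFix_of_isComb U ((TangentCombPoincare.sum_natAbs_eq_zero_iff x j).1 h0), map_one, sub_self, norm_zero]
    exact Finset.sum_nonneg fun l _ => norm_nonneg _
  | succ n ih =>
    intro x j hx
    obtain ⟨k, hjk, hxk, htop⟩ := TangentCombPoincare.exists_top x j (by omega)
    rcases lt_or_gt_of_ne hxk with hneg | hpos
    · -- `x_k < 0`: the plaquette at `x`, next base point `x + e_k`
      have hy : ∑ k' ∈ Finset.Ioi j, ((x + Pi.single k 1 : Site 4) k').natAbs = n := by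
        have h := TangentCombPoincare.sum_natAbs_add_single x hjk 1
        omega
      exact assemble_dist ρ (x, ⟨(j, k), hjk⟩) (fun U => (dist_transport ρ hρ U hjk htop).1) (ih _ j hy)
    · -- `x_k > 0`: the plaquette at `x - e_k`, next base point `x - e_k`
      have htop' : ∀ k' : Fin 4, k < k' → (x - Pi.single k 1 : Site 4) k' = 0 := fun k' hk' => by
        rw [Pi.sub_apply, htop k' hk', Pi.single_eq_of_ne hk'.ne' _, sub_zero]
      have hy : ∑ k' ∈ Finset.Ioi j, ((x - Pi.single k 1 : Site 4) k').natAbs = n := by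
        have h := TangentCombPoincare.sum_natAbs_add_single x hjk (-1)
        rw [← CombBasics.sub_single] at h
        omega
      have key := fun U : LGConfig 4 G => (dist_transport ρ hρ U hjk htop').2
      simp only [sub_add_cancel] at key
      exact assemble_dist ρ (x - Pi.single k 1, ⟨(j, k), hjk⟩) key (ih _ j hy)

/-- **Comb-link energies with LINEAR constants**: for the edge `(x,j)` of comb depth `n` there are `n` plaquettes `q_l` with
`N − Re tr ρ(Ũ(x,j)) ≤ n · Σ_l (N − Re tr ρ(U_{q_l}))` for every configuration (`‖V − 1‖²_F = 2(N − Re tr V)` and Cauchy–Schwarz).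
[cite: arXiv160201222, Lemma 10.2] -/
theorem comb_energy_le (x : Site 4) (j : Fin 4) {n : ℕ} (hn : ∑ k ∈ Finset.Ioi j, (x k).natAbs = n) :
    ∃ f : Fin n → ZdPlaquette 4, ∀ U : LGConfig 4 G,
      (N : ℝ) - (ρ (axialFix U (x, j))).trace.re ≤
        n * ∑ l, ((N : ℝ) - (ρ (plaquetteHolonomyZd U (f l).1 (f l).2.1.1 (f l).2.1.2)).trace.re) := by
  obtain ⟨f, hf⟩ := comb_dist_bound ρ hρ n x j hn
  refine ⟨f, fun U => ?_⟩
  have h1 := TangentCombPoincare.norm_sub_one_sq (hρ (axialFix U (x, j)))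
  have h2 : ∀ l, ‖ρ (plaquetteHolonomyZd U (f l).1 (f l).2.1.1 (f l).2.1.2) - 1‖ ^ 2 =
      2 * ((N : ℝ) - (ρ (plaquetteHolonomyZd U (f l).1 (f l).2.1.1 (f l).2.1.2)).trace.re) := fun l =>
    TangentCombPoincare.norm_sub_one_sq (hρ _)
  have hcs := sq_sum_le_card_mul_sum_sq (s := (Finset.univ : Finset (Fin n)))
    (f := fun l => ‖ρ (plaquetteHolonomyZd U (f l).1 (f l).2.1.1 (f l).2.1.2) - 1‖)
  rw [Finset.card_univ, Fintype.card_fin] at hcs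
  simp only [h2] at hcs
  have hsq : ‖ρ (axialFix U (x, j)) - 1‖ ^ 2 ≤
      (∑ l, ‖ρ (plaquetteHolonomyZd U (f l).1 (f l).2.1.1 (f l).2.1.2) - 1‖) ^ 2 :=
    pow_le_pow_left₀ (norm_nonneg _) (hf U) 2
  rw [← Finset.mul_sum] at hcs
  nlinarith [hcs, hsq, h1]

end Dist

/-! ### Depth bookkeeping -/

/-- The comb depth of an edge is at most the `ℓ¹` size of its base point. [folklore] -/
theorem depth_le_sum (x : Site 4) (j : Fin 4) :
    ((∑ k ∈ Finset.Ioi j, (x k).natAbs : ℕ) : ℝ) ≤ ∑ k : Fin 4, (|x k| : ℝ) := by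
  have h : ∑ k ∈ Finset.Ioi j, (x k).natAbs ≤ ∑ k : Fin 4, (x k).natAbs :=
    Finset.sum_le_sum_of_subset_of_nonneg (Finset.subset_univ _) fun _ _ _ => Nat.zero_le _
  calc ((∑ k ∈ Finset.Ioi j, (x k).natAbs : ℕ) : ℝ) ≤ ((∑ k : Fin 4, (x k).natAbs : ℕ) : ℝ) := by exact_mod_cast h
    _ = ∑ k : Fin 4, (|x k| : ℝ) := by
        push_cast
        exact Finset.sum_congr rfl fun k _ => by rw [Nat.cast_natAbs, Int.cast_abs]

/-- The base points of the boundary links of `p` have `ℓ¹` size at most `1 + Σ_k |p_k|`. [folklore] -/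
theorem sum_abs_boundary_le (p : ZdPlaquette 4) (i : Fin 4) :
    ∑ k : Fin 4, (|(plaquetteBoundary p i).1 k| : ℝ) ≤ 1 + ∑ k : Fin 4, (|p.1 k| : ℝ) := by
  have hsingle : ∀ (m : Fin 4), ∑ k : Fin 4, (|(p.1 + Pi.single m 1 : Site 4) k| : ℝ) ≤ 1 + ∑ k : Fin 4, (|p.1 k| : ℝ) := by
    intro m
    have hle : ∀ k : Fin 4, (|(p.1 + Pi.single m 1 : Site 4) k| : ℝ) ≤ (|p.1 k| : ℝ) + (if k = m then 1 else 0) := by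
      intro k
      rw [Pi.add_apply]
      by_cases hkm : k = m
      · subst hkm
        rw [Pi.single_eq_same, if_pos rfl]
        have h : |p.1 k + 1| ≤ |p.1 k| + 1 := (abs_add_le _ _).trans (by simp)
        exact_mod_cast h
      · rw [Pi.single_eq_of_ne hkm, add_zero, if_neg hkm, add_zero]
    calc ∑ k : Fin 4, (|(p.1 + Pi.single m 1 : Site 4) k| : ℝ)
        ≤ ∑ k : Fin 4, ((|p.1 k| : ℝ) + (if k = m then 1 else 0)) := Finset.sum_le_sum fun k _ => hle k
      _ = 1 + ∑ k : Fin 4, (|p.1 k| : ℝ) := by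
          rw [Finset.sum_add_distrib, Finset.sum_ite_eq' Finset.univ m, if_pos (Finset.mem_univ _)]; ring
  have h0 : ∑ k : Fin 4, (|p.1 k| : ℝ) ≤ 1 + ∑ k : Fin 4, (|p.1 k| : ℝ) := by linarith
  fin_cases i
  · exact h0
  · exact hsingle _
  · exact hsingle _
  · exact h0

/-! ### Part (b): polynomial second moments -/

section Moments

variable {G : Type} [Group G] [TopologicalSpace G] [IsTopologicalGroup G] [CompactSpace G]
  [MeasurableSpace G] [BorelSpace G] [SecondCountableTopology G] (r : LatticeRep G)

/-- **Second moments of the rescaled plaquette field under a plaquette-energy budget**: if `β ≥ 1` and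
`β·∫(N − Re tr ρ(U_q))dμ ≤ E₀` at every plaquette `q` of `ℤ⁴` (finite measure `μ`), then
`∫ (Y_p^a)² dμ ≤ 32·max(E₀,0)·(1 + Σ_k|p_k|)²`. [cite: arXiv160201222, Lemma 10.2] -/
theorem integral_plaqField_sq_le_poly {β : ℝ} (hβ : 1 ≤ β) (μ : Measure (LGConfig 4 G)) [IsFiniteMeasure μ] {E₀ : ℝ}
    (hE : ∀ (x : Site 4) (i j : Fin 4), i ≠ j → β * (∫ U, ((r.N : ℝ) - plaquetteObs r.ρ x i j U) ∂μ) ≤ E₀)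
    (p : ZdPlaquette 4) (a : Fin (lieDim r)) :
    ∫ U, (plaqField r β U p a) ^ 2 ∂μ ≤ 32 * max E₀ 0 * (1 + ∑ k : Fin 4, (|p.1 k| : ℝ)) ^ 2 := by
  have hβ0 : 0 < β := by linarith
  set L : ℝ := 1 + ∑ k : Fin 4, (|p.1 k| : ℝ) with hL
  have hL0 : 0 ≤ L := by positivity
  -- energies: notation, nonnegativity, integrability, budget
  have hEq : ∀ q : ZdPlaquette 4, ∫ U, ((r.N : ℝ) - (r.ρ (plaquetteHolonomyZd U q.1 q.2.1.1 q.2.1.2)).trace.re) ∂μ ≤ max E₀ 0 / β := by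
    intro q
    have h := hE q.1 q.2.1.1 q.2.1.2 (ne_of_lt q.2.2)
    rw [le_div_iff₀ hβ0, mul_comm]
    exact h.trans (le_max_left _ _)
  have hEint : ∀ q : ZdPlaquette 4, Integrable (fun U => (r.N : ℝ) - (r.ρ (plaquetteHolonomyZd U q.1 q.2.1.1 q.2.1.2)).trace.re) μ :=
    fun q => TangentPlaquetteEnergy.integrable_sub_plaquetteObs r.ρ r.continuous r.mem_unitary μ q.1 q.2.1.1 q.2.1.2
  -- comb-link energies of the four boundary links, with linear constants
  have hdepth : ∀ i : Fin 4, ∃ (n : ℕ) (f : Fin n → ZdPlaquette 4), (n : ℝ) ≤ L ∧ ∀ U : LGConfig 4 G,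
      (r.N : ℝ) - (r.ρ (axialFix U (plaquetteBoundary p i))).trace.re ≤
        n * ∑ l, ((r.N : ℝ) - (r.ρ (plaquetteHolonomyZd U (f l).1 (f l).2.1.1 (f l).2.1.2)).trace.re) := by
    intro i
    obtain ⟨f, hf⟩ := comb_energy_le r.ρ r.mem_unitary (plaquetteBoundary p i).1 (plaquetteBoundary p i).2 rfl
    exact ⟨_, f, (depth_le_sum _ _).trans (sum_abs_boundary_le p i), hf⟩
  choose n f hnL hW using hdepth
  -- pointwise bound by an integrable function
  have hpt : ∀ U : LGConfig 4 G, (plaqField r β U p a) ^ 2 ≤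
      8 * β * ∑ i : Fin 4, ((n i : ℝ) * ∑ l, ((r.N : ℝ) - (r.ρ (plaquetteHolonomyZd U (f i l).1 (f i l).2.1.1 (f i l).2.1.2)).trace.re)) := by
    intro U
    refine (TangentFieldMoments.plaqField_sq_le r β U p a).trans ?_
    rw [Real.sq_sqrt hβ0.le, Finset.mul_sum, Finset.mul_sum]
    refine Finset.sum_le_sum fun i _ => ?_
    have h := hW i U
    have hb : 0 ≤ β := hβ0.le
    nlinarith [mul_le_mul_of_nonneg_left h hb]
  have hint : Integrable (fun U : LGConfig 4 G => 8 * β * ∑ i : Fin 4, ((n i : ℝ) *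
      ∑ l, ((r.N : ℝ) - (r.ρ (plaquetteHolonomyZd U (f i l).1 (f i l).2.1.1 (f i l).2.1.2)).trace.re))) μ :=
    (integrable_finsetSum _ fun i _ => (integrable_finsetSum _ fun l _ => hEint (f i l)).const_mul _).const_mul _
  calc ∫ U, (plaqField r β U p a) ^ 2 ∂μ
      ≤ ∫ U, 8 * β * ∑ i : Fin 4, ((n i : ℝ) *
          ∑ l, ((r.N : ℝ) - (r.ρ (plaquetteHolonomyZd U (f i l).1 (f i l).2.1.1 (f i l).2.1.2)).trace.re)) ∂μ :=
        integral_mono (TangentFieldMoments.integrable_plaqField_sq r β μ p a) hint hpt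
    _ = 8 * β * ∑ i : Fin 4, ((n i : ℝ) *
          ∑ l, ∫ U, ((r.N : ℝ) - (r.ρ (plaquetteHolonomyZd U (f i l).1 (f i l).2.1.1 (f i l).2.1.2)).trace.re) ∂μ) := by
        rw [integral_const_mul, integral_finsetSum _ fun i _ => (integrable_finsetSum _ fun l _ => hEint (f i l)).const_mul _]
        refine congrArg _ (Finset.sum_congr rfl fun i _ => ?_)
        rw [integral_const_mul, integral_finsetSum _ fun l _ => hEint (f i l)]
    _ ≤ 8 * β * ∑ i : Fin 4, ((n i : ℝ) * ∑ _l : Fin (n i), max E₀ 0 / β) := by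
        refine mul_le_mul_of_nonneg_left (Finset.sum_le_sum fun i _ =>
          mul_le_mul_of_nonneg_left (Finset.sum_le_sum fun l _ => hEq _) (Nat.cast_nonneg _)) (by positivity)
    _ = 8 * max E₀ 0 * ∑ i : Fin 4, ((n i : ℝ) * (n i : ℝ)) := by
        simp only [Finset.sum_const, Finset.card_univ, Fintype.card_fin, nsmul_eq_mul]
        rw [Finset.mul_sum, Finset.mul_sum]
        refine Finset.sum_congr rfl fun i _ => ?_
        field_simp
    _ ≤ 8 * max E₀ 0 * ∑ _i : Fin 4, L * L := by
        refine mul_le_mul_of_nonneg_left (Finset.sum_le_sum fun i _ => ?_) (by positivity)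
        exact mul_le_mul (hnL i) (hnL i) (Nat.cast_nonneg _) hL0
    _ = 32 * max E₀ 0 * (1 + ∑ k : Fin 4, (|p.1 k| : ℝ)) ^ 2 := by
        simp only [Finset.sum_const, Finset.card_univ, Fintype.card_fin, nsmul_eq_mul, hL]; ring

end Moments

end FieldBounds

open FieldBounds

/-- **Stub `stub_fieldBounds` of line `birth` (crux U, stmt-QuantumFields-23756)** — (a) on the time axis the squared rescaled
plaquette field is dominated by `2β` times the plaquette energy (comb gauge, one live link, Bessel); (b) second moments of the field are
bounded polynomially in the position, `≤ 32·max(E₀,0)·(1 + Σ_k|p_k|)²`, under a plaquette-energy budget (comb Poincaré with linear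
constants).  NOT THE CLAY GAP. -/
theorem stub_fieldBounds :
    ∀ (G : Type) [Group G] [TopologicalSpace G] [IsTopologicalGroup G] [CompactSpace G]
      [MeasurableSpace G] [BorelSpace G],
      Literature.MathematicalPhysics.QuantumFieldTheory.IsCompactSimpleLieGroup G →
      ∀ r : Literature.MathematicalPhysics.QuantumFieldTheory.LatticeRep G,
        (∀ β : ℝ, 0 < β → ∀ (x : Literature.Probability.LatticeModels.Site 4), (∀ k : Fin 4, k ≠ 0 → x k = 0) →
          ∀ U : Literature.MathematicalPhysics.QuantumLattice.LGConfig 4 G,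
            ∑ a : Fin (Summit.QuantumFields.YangMills.Theorems.EquipartitionPinsProbe.lieDim r), (Summit.QuantumFields.YangMills.Theorems.EquipartitionPinsProbe.plaqField r β U (Literature.MathematicalPhysics.QuantumFieldTheory.plaquette12 (d := 4) (by norm_num) x) a) ^ 2 ≤
              2 * β * ((r.N : ℝ) - Literature.MathematicalPhysics.QuantumLattice.plaquetteObs r.ρ x 1 2 U)) ∧
        (∀ E₀ : ℝ, ∃ Cm c : ℝ, 0 ≤ Cm ∧ ∀ β : ℝ, 1 ≤ β →
          ∀ μ ∈ Literature.MathematicalPhysics.QuantumLattice.infiniteVolumeLimitPoints (d := 4) r.ρ β,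
            (∀ (x : Literature.Probability.LatticeModels.Site 4) (i j : Fin 4), i ≠ j →
              β * (∫ U, ((r.N : ℝ) - Literature.MathematicalPhysics.QuantumLattice.plaquetteObs r.ρ x i j U) ∂μ) ≤ E₀) →
            ∀ (p : Literature.MathematicalPhysics.QuantumLattice.ZdPlaquette 4) (a : Fin (Summit.QuantumFields.YangMills.Theorems.EquipartitionPinsProbe.lieDim r)),
              MeasureTheory.Integrable (fun U => (Summit.QuantumFields.YangMills.Theorems.EquipartitionPinsProbe.plaqField r β U p a) ^ 2) μ ∧
              ∫ U, (Summit.QuantumFields.YangMills.Theorems.EquipartitionPinsProbe.plaqField r β U p a) ^ 2 ∂μ ≤ Cm * (1 + ∑ k : Fin 4, (|p.1 k| : ℝ)) ^ c) := by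
  intro G _ _ _ _ _ _ _hG r
  refine ⟨fun β hβ x hx U => ?_, fun E₀ => ⟨32 * max E₀ 0, 2, by positivity, fun β hβ μ hμ hE p a => ?_⟩⟩
  · -- (a): the axis identity, Bessel, and the axis energy identity
    have hY : ∀ a, (plaqField r β U (plaquette12 (d := 4) (by norm_num) x) a) ^ 2 =
        β * (lieCoord r (r.ρ (axialFix U (x + Pi.single 2 1, 1)) - 1) a) ^ 2 := fun a => by
      rw [ProbeCovFromPairLaw.axis_plaqField r β U hx a, neg_sq, mul_pow, Real.sq_sqrt hβ.le]
    simp only [hY, ← Finset.mul_sum]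
    rw [ProbeCovFromPairLaw.axis_energy r U hx]
    have hB := TangentSecondMoments.sum_lieCoord_sq_le r (axialFix U (x + Pi.single 2 1, 1))
    nlinarith [mul_le_mul_of_nonneg_left hB hβ.le]
  · -- (b): polynomial second moments
    haveI : T2Space G := (r.continuous.isClosedEmbedding r.injective).isEmbedding.t2Space
    haveI : SecondCountableTopology G :=
      (r.continuous.isClosedEmbedding r.injective).isEmbedding.secondCountableTopology
    haveI : IsProbabilityMeasure μ := by obtain ⟨_, _, hprob, _⟩ := hμ; exact hprob
    refine ⟨TangentFieldMoments.integrable_plaqField_sq r β μ p a, ?_⟩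
    rw [show ((2 : ℝ)) = ((2 : ℕ) : ℝ) by norm_num, Real.rpow_natCast]
    exact integral_plaqField_sq_le_poly r hβ μ hE p a

end Summit.QuantumFields.YangMills.Cruxes.FreeProbeLawG.SteinFree

end
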